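import Summits.QuantumFields.YangMills.Theorems.BalabanUVNodesN07CritLamTransferMeet
import Summits.QuantumFields.YangMills.Theorems.BalabanUVNodesN21ReadSetSupport
import Summits.QuantumFields.YangMills.Theorems.BalabanUVNodesN07TowerGaugeCoverLift
import Literature.MathematicalPhysics.QuantumFieldTheory.Balaban1983to89.Node00.TorusCoverCubeDomains
import Literature.MathematicalPhysics.QuantumFieldTheory.Balaban1983to89.Node00.Sect2FrameOfRecord
import Summits.QuantumFields.YangMills.Theorems.UnitScaleTiltProp7BondAvgIterCoercivity
import HarnessLib

/-!
# N07 [B11] ∕ K0⁷ road, chart side — MODULE 104: **THE THREE SURGERY CLAUSES AT THE (144) CUBE TOWER** — for the per-cube family `cubeDomains ⊓ D₂` of ANY second family, with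
# `R₀ := (regionOfSet (π″□₀)).bonds` and `R₁ :=` the fine bonds with an end point in `Ω₁ = π″□₁` of the cube family: (i) bonds off `R₁` are level-0 cells, (ii) a plaquette
# meeting `R₁` lies in `R₀` (collar `ρ ≥ 1` between `□₁` and `□₀`), (iii) a cell of level `j ≥ 1` is fed inside `π″□₀` (collar `ρL^{j−1} ≥ 3L^j`, i.e. `ρ ≥ 3L`), a level-0 cell
# is in `R₀` or off `R₁`; hence MODULE 103's composition with the clauses DISCHARGED: print's criticality of the record's minimiser transported to the globally read chart
# configuration on the meet fibre — the cell-form (d′) in-edge, modulo the reading seam only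

Cell `pub-ymgap`, seat `pub-ymgap-dag-n07-e` g29 (FAN-OUT §N07 row s3; LANE OWNER of the K0 road chart side), MODULE 104 = repair (R2)(d) of ⚑ LOCATED-DPRIME-CALIBRATION.
`--kind proof --supports stmt-QuantumFields-20541 --as helper` (K0⁷); count-neutral; theorems only.  [15] = [Balaban1985Variational]; [6] = [Balaban1985RegularSpaces];
[B6] = [Balaban1984PropagatorsII]; [III] = [Balaban1988Convergent]; [I] = [Balaban1987RG1].

WHY.  MODULE 103 `critLam_meet_of_critLam_seq_of_eqOn` displays three geometric clauses on regions `R₀`, `R₁` of fine bonds.  At the (144) tower `□₀ ⊃ □₁ ⊃ … ⊃ □_{k′}` of a datum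
(`B8Eq131Cubes.cube`, margins `m_j = Lʲ·ρ·Σ_{i ≤ k′−j} Lⁱ`, so `m_{j−1} − m_j = ρL^{j−1}`, [6] p. 98) with the torus family `Node00.cubeDomains` (`Ω_j^{(j)} = π_j(□_j^{(j)})`), take
`R₁ := {b | B¹(b₋) ∈ Ω₁^{(1)} ∨ B¹(b₊) ∈ Ω₁^{(1)}}` and `R₀ := (regionOfSet (π″□₀)).bonds` (the region of the head token's (T1) gauge equation): (i) is the definition of `Λ₀ = Ω₁ᶜ`
([B6] (2.3)) read on the meet (`Deep_meet ⇒ Deep_cube`); (ii) a fine site of `Ω₁` is `π z`, `z ∈ □₁` (§1, a deck translation — NO injectivity of `π` needed), the four corners of a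
plaquette through it are `π(z′)` with `‖z′ − z‖_∞ ≤ 1`, and `m₁ + 1 ≤ m₀` (`ρ ≥ 1`); (iii) for a meet-cell `c` of level `j ≥ 1` one end block lies in `Ω_j^{(j)} ⊆ π_j(□_j^{(j)})`, every
feeding bond has its source within `2Lʲ − 2` (on the cover) of a point over `B(c₋)` (n21-e `N21ReadSetSupport.feeds_witness`, [III] (2.11)), hence within `3Lʲ − 2` of a point of
`□_j`, and `m_j + 3Lʲ ≤ m₀` when `ρ ≥ 3L`; a level-0 cell is its own feed.  §4 plugs (i)–(iii) into MODULE 103: from print's criticality of `U` on the whole sequence family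
`domainsOfSeq Ω k` and the (T1)-type agreement `Ũ = u • U` on `R₀`, the globally read `Ũ` is print-critical on the fibre of `cubeDomains ⊓ domainsOfSeq Ω k′` through its own
averages — the cell-form in-edge of the (d′) supplier (memo (R1)), every datum, plain meet.

WHAT IS PROVED (sorry-free; no definition; axioms standard; `P` a torus of the record, `1 ≤ k ≤ m + K` the tower depth).  §1 (the period identity `N₀ = Lʲ·N_j` is ym3's `Prop7FlatCoercivity.sitesPerDir_zero_eq_pow_mul`, by name) ★ `exists_translate_mem_cube_of_coverAt_eq` (deck
translation of a cover point into `□_j` from its level-`j` label), ★ `exists_mem_cube_cover_eq_of_inOm` (a fine site of `Ω_j` is `π z`, `z ∈ □_j`), `mem_cube_zero_of_within`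
(collar arithmetic `m_j + t ≤ m₀`), `margin_one_add_le`, `margin_add_three_pow_le`; §2 ★★ `pin_clause_tower` (i), ★★ `collar_clause_tower` (ii); §3 ★★ `feeds_clause_tower` (iii);
§4 ★★★ `critLam_meet_tower_of_critLam_seq_of_eqOn` (MODULE 103 with (i)–(iii) discharged: hypotheses `1 ≤ k′ ≤ k`, `3L ≤ ρ`, print-criticality of `U` on `domainsOfSeq Ω k`,
`Ũ = u • U` on `(regionOfSet (π″□₀)).bonds`).
HONEST FRAMING: torus∕lattice bookkeeping by name over n21-e's collar API, NODE 00's cube family and MODULES 101–103; NOTHING of [15]'s estimates asserted; the reading seam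
(b)∕(ii) NOT touched (the input is print's cell-form criticality, memo (R4)); (d′) ∕ `HThm4RecDbar` ∕ budget row of MODULE 100 untouched; K0⁷ NOT closed; N07 NOT discharged; counts
unmoved; one finite 𝕋⁴ programme at fixed ε — NOT continuum ∕ ℝ⁴ ∕ OS ∕ mass gap ∕ Clay.  No `sorry`, no `def`, no `instance`, no `notation`.

References: [15] (5)–(6) p.278, (144) p.300, (147)–(153) p.301, Prop. 8 p.304; [6] (1.131) p.99, p.98; [B6] (2.1)–(2.3) p.224; [III] (2.10)–(2.12) p.256; [I] (0.1)–(0.4) pp.251–253.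
-/

set_option autoImplicit false

noncomputable section

open scoped Matrix.Norms.L2Operator Topology BigOperators
open Filter

namespace Summit.QuantumFields.YangMills.BalabanUVNodes.N07CritLamTowerClauses

open Literature.MathematicalPhysics.QuantumFieldTheory.Balaban1983to89
open Literature.MathematicalPhysics.QuantumFieldTheory.Balaban1983to89.T4Continuum (T4Family)
open Literature.MathematicalPhysics.QuantumFieldTheory.Balaban1983to89.B15DeterminingSets
open Literature.MathematicalPhysics.QuantumFieldTheory.Balaban1983to89.B5Eq118OneStroke (iterBlockOf)
open Literature.MathematicalPhysics.QuantumFieldTheory.Balaban1983to89.B6SectADomainsV1 (Domains)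
open Literature.MathematicalPhysics.QuantumFieldTheory.Balaban1983to89.B14.Eq216Concrete (feeds feeds_zero)
open Literature.MathematicalPhysics.QuantumFieldTheory.Balaban1983to89.B14DomainGeom (Pt Within)
open Literature.MathematicalPhysics.QuantumFieldTheory.Balaban1983to89.B15Eq112TorusCover (cover lift cover_lift)
open Literature.MathematicalPhysics.QuantumFieldTheory.Balaban1983to89.B8Eq131Cubes (cube sqLo sqHi bLo bHi gs cube_eq cube_anti margin_succ margin_anti)
open Literature.MathematicalPhysics.QuantumFieldTheory.Balaban1983to89.Node00
open Literature.MathematicalPhysics.QuantumLattice (blockMap)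
open Summit.QuantumFields.YangMills.Theorems.N21ReadSetSupport (feeds_witness within_add_single within_sub_single eq_of_shift_eq blockIter_cover_add_single)
open Summit.QuantumFields.YangMills.BalabanUVNodes.N07TowerGaugeCoverLift (blockIter_cover)
open Summit.QuantumFields.YangMills.BalabanUVNodes.N07CritLamTransferMeet (critLam_meet_of_critLam_seq_of_eqOn)

variable {P : Params}

/-! ## §1  Deck translations into the cubes; the collar arithmetic -/

section Geometry

variable {a : Pt P.d} {M ρ k : ℕ} {hk : k ≤ P.m + P.K}

/-- `Within` is translation invariant. [folklore] -/
theorem within_add_right_iff {r : ℤ} (x y w : Pt P.d) : Within r (x + w) (y + w) ↔ Within r x y := by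
  refine forall_congr' fun i => ?_
  rw [Pi.add_apply, Pi.add_apply, add_sub_add_right_eq_sub]

/-- ★ **DECK TRANSLATION INTO `□_j`**: if the level-`j` cover of the `Lʲ`-block label of a cover point `x` is a label of `Ω_j^{(j)} = π_j(□_j^{(j)})` (`1 ≤ j ≤ k`), some deck
translate `x + N₀·v` of `x` lies in `□_j` (no injectivity of `π` needed). [cite: Balaban1985RegularSpaces, (1.131) p.99; Balaban1987RG1, (0.1) p.251] -/
theorem exists_translate_mem_cube_of_coverAt_eq {j : ℕ} (hj : 1 ≤ j) (hjk : j ≤ k) {x : Pt P.d} {y : Site P j}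
    (hy : y ∈ (cubeDomains P a M ρ k hk).Om j) (hx : coverAt P j (blockMap (P.L ^ j) x) = y) :
    ∃ v : Pt P.d, x + (fun μ => ((P.sitesPerDir 0 : ℕ) : ℤ) * v μ) ∈ cube P.L a M ρ k j := by
  obtain ⟨s, hs, hse⟩ := (mem_cubeDomains_Om_iff hj hjk y).1 hy
  have hts : coverAt P j (blockMap (P.L ^ j) x) = coverAt P j s := by rw [hx, hse]
  have hdvd := (coverAt_eq_coverAt_iff j _ _).1 hts
  choose v hv using hdvd
  refine ⟨v, mem_cube_of_blockMap_inBox (n := j) ?_⟩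
  have hblk : blockMap (P.L ^ j) (x + fun μ => ((P.sitesPerDir 0 : ℕ) : ℤ) * v μ) = s := by
    funext μ
    simp only [blockMap, Pi.add_apply]
    rw [Summit.QuantumFields.YangMills.Theorems.Prop7FlatCoercivity.sitesPerDir_zero_eq_pow_mul (hjk.trans hk)]
    push_cast
    rw [show x μ + (P.L : ℤ) ^ j * (P.sitesPerDir j : ℤ) * v μ = x μ + (P.L : ℤ) ^ j * ((P.sitesPerDir j : ℤ) * v μ) by ring,
      Int.add_mul_ediv_left _ _ (pow_ne_zero _ (by exact_mod_cast P.L_pos.ne'))]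
    have := hv μ
    simp only [blockMap] at this
    push_cast at this
    linarith
  rw [hblk]
  exact hs

/-- ★ **A FINE SITE OF `Ω_j` IS THE COVER OF A POINT OF `□_j`** (`1 ≤ j ≤ k`; no injectivity of `π`). [cite: Balaban1985RegularSpaces, (1.131) p.99; Balaban1984PropagatorsII, (2.2) p.224] -/
theorem exists_mem_cube_cover_eq_of_inOm {j : ℕ} (hj : 1 ≤ j) (hjk : j ≤ k) {x : Site P 0} (hx : (cubeDomains P a M ρ k hk).InOm j x) :
    ∃ z : Pt P.d, z ∈ cube P.L a M ρ k j ∧ cover P z = x := by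
  have h1 : iterBlockOf j (cover P (lift P x)) = coverAt P j (blockMap (P.L ^ j) (lift P x)) := iterBlockOf_cover (hjk.trans hk) _
  rw [cover_lift] at h1
  obtain ⟨v, hv⟩ := exists_translate_mem_cube_of_coverAt_eq (hk := hk) hj hjk (x := lift P x) hx h1.symm
  refine ⟨_, hv, ?_⟩
  rw [← coverAt_zero, coverAt_add_period 0 (lift P x) v, coverAt_zero, cover_lift]

/-- **COLLAR ARITHMETIC**: a point within sup-distance `t` of `□_j` lies in `□₀` when `m_j + t ≤ m₀`. [cite: Balaban1985RegularSpaces, p.98 («a distance between boundaries of these cubes is equal to R₁M₁Lʲη»)] -/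
theorem mem_cube_zero_of_within {j t : ℕ} (hjk : j ≤ k) (hmargin : P.L ^ j * (ρ * gs P.L (k - j)) + t ≤ ρ * gs P.L k)
    {z z' : Pt P.d} (hz : z ∈ cube P.L a M ρ k j) (hw : Within (t : ℤ) z z') : z' ∈ cube P.L a M ρ k 0 := by
  rw [cube_eq hjk] at hz
  rw [cube_eq (Nat.zero_le k)]
  have hm : (((P.L ^ j * (ρ * gs P.L (k - j)) : ℕ) : ℤ) + (t : ℤ)) ≤ ((ρ * gs P.L k : ℕ) : ℤ) := by exact_mod_cast hmargin
  intro i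
  obtain ⟨h1, h2⟩ := hz i
  have h3 := abs_le.1 (hw i)
  simp only [bLo, bHi, pow_zero, one_mul, Nat.sub_zero] at h1 h2 ⊢
  constructor <;> push_cast at h1 h2 hm ⊢ <;> linarith [h3.1, h3.2]

/-- `m₁ + ρ = m₀` (`1 ≤ k`): in particular `m₁ + 1 ≤ m₀` for `ρ ≥ 1`. [cite: Balaban1985RegularSpaces, p.98] -/
theorem margin_one_add_le (hk1 : 1 ≤ k) {t : ℕ} (ht : t ≤ ρ) : P.L ^ 1 * (ρ * gs P.L (k - 1)) + t ≤ ρ * gs P.L k := by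
  have h := margin_succ (L := P.L) (ρ := ρ) (k := k) (j := 0) hk1
  simp only [pow_zero, one_mul, Nat.sub_zero, zero_add, mul_one] at h
  omega

/-- `m_j + 3Lʲ ≤ m₀` for `1 ≤ j ≤ k` and `ρ ≥ 3L` (`m_{j−1} = m_j + ρL^{j−1} ≤ m₀`). [cite: Balaban1985RegularSpaces, p.98] -/
theorem margin_add_three_pow_le {j : ℕ} (hj : 1 ≤ j) (hjk : j ≤ k) (hρ : 3 * P.L ≤ ρ) {t : ℕ} (ht : t ≤ 3 * P.L ^ j) :
    P.L ^ j * (ρ * gs P.L (k - j)) + t ≤ ρ * gs P.L k := by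
  obtain ⟨i, rfl⟩ : ∃ i, j = i + 1 := ⟨j - 1, by omega⟩
  have h1 := margin_succ (L := P.L) (ρ := ρ) (k := k) (j := i) (by omega)
  have h2 := margin_anti P.L ρ k 0 i (Nat.zero_le i) (by omega)
  simp only [pow_zero, one_mul, Nat.sub_zero] at h2
  have h3 : 3 * P.L ^ (i + 1) ≤ ρ * P.L ^ i := by
    rw [pow_succ]
    calc 3 * (P.L ^ i * P.L) = 3 * P.L * P.L ^ i := by ring
      _ ≤ ρ * P.L ^ i := Nat.mul_le_mul_right _ hρ
  omega

end Geometry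

/-! ## §2  Clauses (i) and (ii) at the tower -/

section Clauses

variable (a : Pt P.d) (M ρ k : ℕ) (hk : k ≤ P.m + P.K) (D₂ : Domains P)

/-- ★★ **CLAUSE (i)**: a fine bond with NO end point in `Ω₁` of the cube family is a level-0 cell of the meet `cubeDomains ⊓ D₂` (`Λ₀ = Ω₁ᶜ`, [B6] (2.3); the meet is deeper only
where both families are). [cite: Balaban1984PropagatorsII, (2.3) p.224; Balaban1985Variational, (150) p.301] -/
theorem pin_clause_tower (b : PBond P 0)
    (hb : b ∉ {b : PBond P 0 | (cubeDomains P a M ρ k hk).InOm 1 b.src ∨ (cubeDomains P a M ρ k hk).InOm 1 b.tgt}) :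
    (domainsMeet (cubeDomains P a M ρ k hk) D₂).LamBond 0 b := by
  rw [Domains.lamBond_zero_iff]
  simp only [Set.mem_setOf_eq, not_or] at hb
  constructor
  · exact not_deep_of_domainsLe (domainsMeet_le_left _ _) (fun h => hb.1 ((Domains.deep_iterBlockOf_iff _ 0 b.src).1 h))
  · exact not_deep_of_domainsLe (domainsMeet_le_left _ _) (fun h => hb.2 ((Domains.deep_iterBlockOf_iff _ 0 b.tgt).1 h))

variable {a M ρ k hk}

/-- The four corners of a plaquette through a fine site of `Ω₁` lie in `π″□₀` (collar `ρ ≥ 1`): the site is `π z`, `z ∈ □₁`, the base corner is `π z₀` with `z = z₀ + δ`,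
`δ ∈ {0, e_μ, e_ν, e_μ + e_ν}`, and every corner `π(z₀ + δ′)` has `‖(z₀ + δ′) − z‖_∞ ≤ 1`. [cite: Balaban1985RegularSpaces, p.98; Balaban1987RG1, (0.1) p.251] -/
theorem corners_mem_of_inOm_one (hk1 : 1 ≤ k) (hρ : 1 ≤ ρ) (p : Plaq P 0) {x : Site P 0} (hx : (cubeDomains P a M ρ k hk).InOm 1 x)
    (hcorner : x = p.src ∨ x = p.src.shift p.μ ∨ x = p.src.shift p.ν ∨ x = (p.src.shift p.μ).shift p.ν) :
    p.src ∈ cover P '' cube P.L a M ρ k 0 ∧ p.src.shift p.μ ∈ cover P '' cube P.L a M ρ k 0 ∧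
      p.src.shift p.ν ∈ cover P '' cube P.L a M ρ k 0 ∧ (p.src.shift p.μ).shift p.ν ∈ cover P '' cube P.L a M ρ k 0 := by
  obtain ⟨z, hz, hzx⟩ := exists_mem_cube_cover_eq_of_inOm (hk := hk) le_rfl hk1 hx
  -- the base corner as a cover point `z₀` with `z = z₀ + δ`, `δ` a sum of at most the two unit vectors
  have key : ∃ z₀ : Pt P.d, cover P z₀ = p.src ∧ ∀ i, 0 ≤ z i - z₀ i ∧ z i - z₀ i ≤ 1 := by
    rcases hcorner with h | h | h | h
    · exact ⟨z, by rw [hzx, h], fun i => by simp⟩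
    · refine ⟨z - Pi.single p.μ 1, ?_, fun i => ?_⟩
      · apply eq_of_shift_eq (μ := p.μ)
        rw [← B15Claim189CubePin.cover_add_single, sub_add_cancel, hzx, h]
      · by_cases hi : i = p.μ <;> simp [hi]
    · refine ⟨z - Pi.single p.ν 1, ?_, fun i => ?_⟩
      · apply eq_of_shift_eq (μ := p.ν)
        rw [← B15Claim189CubePin.cover_add_single, sub_add_cancel, hzx, h]
      · by_cases hi : i = p.ν <;> simp [hi]
    · refine ⟨z - Pi.single p.μ 1 - Pi.single p.ν 1, ?_, fun i => ?_⟩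
      · apply eq_of_shift_eq (μ := p.ν)
        apply eq_of_shift_eq (μ := p.μ)
        rw [← B15Claim189CubePin.cover_add_single, ← B15Claim189CubePin.cover_add_single, Site.shift_comm]
        rw [show z - Pi.single p.μ 1 - Pi.single p.ν 1 + Pi.single p.ν 1 + Pi.single p.μ 1 = z by abel, hzx, h]
      · have hμν : p.μ ≠ p.ν := p.hμν.ne
        by_cases hi : i = p.μ
        · subst hi; simp [hμν]
        · by_cases hi' : i = p.ν
          · subst hi'; simp [hi]
          · simp [hi, hi']
  obtain ⟨z₀, hz₀, hδ⟩ := key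
  have hμν : p.μ ≠ p.ν := p.hμν.ne
  -- every corner `z₀ + δ′` is within sup-distance `1` of `z`
  have hw : ∀ δ' : Pt P.d, (∀ i, 0 ≤ δ' i ∧ δ' i ≤ 1) → Within (1 : ℕ) z (z₀ + δ') := by
    intro δ' hδ' i
    rw [Nat.cast_one, abs_le, Pi.add_apply]
    constructor <;> linarith [(hδ i).1, (hδ i).2, (hδ' i).1, (hδ' i).2]
  have hm : P.L ^ 1 * (ρ * gs P.L (k - 1)) + 1 ≤ ρ * gs P.L k := margin_one_add_le hk1 hρ
  have hin : ∀ δ' : Pt P.d, (∀ i, 0 ≤ δ' i ∧ δ' i ≤ 1) → cover P (z₀ + δ') ∈ cover P '' cube P.L a M ρ k 0 :=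
    fun δ' hδ' => ⟨_, mem_cube_zero_of_within hk1 hm hz (hw δ' hδ'), rfl⟩
  have e0 : p.src = cover P (z₀ + 0) := by rw [add_zero, hz₀]
  have e1 : p.src.shift p.μ = cover P (z₀ + Pi.single p.μ 1) := by rw [B15Claim189CubePin.cover_add_single, hz₀]
  have e2 : p.src.shift p.ν = cover P (z₀ + Pi.single p.ν 1) := by rw [B15Claim189CubePin.cover_add_single, hz₀]
  have e3 : (p.src.shift p.μ).shift p.ν = cover P (z₀ + (Pi.single p.μ 1 + Pi.single p.ν 1)) := by
    rw [← add_assoc, B15Claim189CubePin.cover_add_single, B15Claim189CubePin.cover_add_single, hz₀]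
  refine ⟨e0 ▸ hin 0 (fun i => by simp), e1 ▸ hin _ (fun i => ?_), e2 ▸ hin _ (fun i => ?_), e3 ▸ hin _ (fun i => ?_)⟩
  · by_cases hi : i = p.μ <;> simp [hi]
  · by_cases hi : i = p.ν <;> simp [hi]
  · by_cases hi : i = p.μ
    · subst hi; simp [hμν]
    · by_cases hi' : i = p.ν
      · subst hi'; simp [hi]
      · simp [hi, hi']

/-- ★★ **CLAUSE (ii)**: a plaquette one of whose bonds has an end point in `Ω₁` of the cube family has all four bonds in `(regionOfSet (π″□₀)).bonds` (collar `ρ ≥ 1`).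
[cite: Balaban1985RegularSpaces, p.98; Balaban1985Variational, (144) p.300] -/
theorem collar_clause_tower (hk1 : 1 ≤ k) (hρ : 1 ≤ ρ) (p : Plaq P 0)
    (h : (⟨p.src, p.μ⟩ : PBond P 0) ∈ {b : PBond P 0 | (cubeDomains P a M ρ k hk).InOm 1 b.src ∨ (cubeDomains P a M ρ k hk).InOm 1 b.tgt} ∨
      (⟨p.src.shift p.μ, p.ν⟩ : PBond P 0) ∈ {b : PBond P 0 | (cubeDomains P a M ρ k hk).InOm 1 b.src ∨ (cubeDomains P a M ρ k hk).InOm 1 b.tgt} ∨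
      (⟨p.src.shift p.ν, p.μ⟩ : PBond P 0) ∈ {b : PBond P 0 | (cubeDomains P a M ρ k hk).InOm 1 b.src ∨ (cubeDomains P a M ρ k hk).InOm 1 b.tgt} ∨
      (⟨p.src, p.ν⟩ : PBond P 0) ∈ {b : PBond P 0 | (cubeDomains P a M ρ k hk).InOm 1 b.src ∨ (cubeDomains P a M ρ k hk).InOm 1 b.tgt}) :
    (⟨p.src, p.μ⟩ : PBond P 0) ∈ (Sect2.regionOfSet P (cover P '' cube P.L a M ρ k 0)).bonds ∧
      (⟨p.src.shift p.μ, p.ν⟩ : PBond P 0) ∈ (Sect2.regionOfSet P (cover P '' cube P.L a M ρ k 0)).bonds ∧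
      (⟨p.src.shift p.ν, p.μ⟩ : PBond P 0) ∈ (Sect2.regionOfSet P (cover P '' cube P.L a M ρ k 0)).bonds ∧
      (⟨p.src, p.ν⟩ : PBond P 0) ∈ (Sect2.regionOfSet P (cover P '' cube P.L a M ρ k 0)).bonds := by
  -- some corner of `p` lies in `Ω₁`
  have hνμ : (p.src.shift p.ν).shift p.μ = (p.src.shift p.μ).shift p.ν := Site.shift_comm _ _ _
  obtain ⟨x, hx, hcorner⟩ : ∃ x : Site P 0, (cubeDomains P a M ρ k hk).InOm 1 x ∧
      (x = p.src ∨ x = p.src.shift p.μ ∨ x = p.src.shift p.ν ∨ x = (p.src.shift p.μ).shift p.ν) := by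
    simp only [Set.mem_setOf_eq] at h
    rcases h with (h | h) | (h | h) | (h | h) | (h | h)
    · exact ⟨_, h, Or.inl rfl⟩
    · exact ⟨_, h, Or.inr (Or.inl rfl)⟩
    · exact ⟨_, h, Or.inr (Or.inl rfl)⟩
    · exact ⟨_, h, Or.inr (Or.inr (Or.inr rfl))⟩
    · exact ⟨_, h, Or.inr (Or.inr (Or.inl rfl))⟩
    · exact ⟨_, h, Or.inr (Or.inr (Or.inr (by rw [← hνμ]; rfl)))⟩
    · exact ⟨_, h, Or.inl rfl⟩
    · exact ⟨_, h, Or.inr (Or.inr (Or.inl rfl))⟩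
  obtain ⟨c0, c1, c2, c3⟩ := corners_mem_of_inOm_one hk1 hρ p hx hcorner
  have c3' : (p.src.shift p.ν).shift p.μ ∈ cover P '' cube P.L a M ρ k 0 := by rw [hνμ]; exact c3
  exact ⟨⟨c0, c1⟩, ⟨c1, c3⟩, ⟨c2, c3'⟩, ⟨c0, c2⟩⟩

end Clauses

/-! ## §3  Clause (iii) at the tower: the feeding bonds of the meet-cells -/

section Feeds

variable {a : Pt P.d} {M ρ k : ℕ} {hk : k ≤ P.m + P.K} (D₂ : Domains P)

/-- A fine bond with an end point in `Ω₁` of the cube family lies in `(regionOfSet (π″□₀)).bonds` (collar `ρ ≥ 1`). [cite: Balaban1985RegularSpaces, p.98] -/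
theorem mem_bonds_of_inOm_one (hk1 : 1 ≤ k) (hρ : 1 ≤ ρ) {b : PBond P 0}
    (hb : (cubeDomains P a M ρ k hk).InOm 1 b.src ∨ (cubeDomains P a M ρ k hk).InOm 1 b.tgt) :
    b ∈ (Sect2.regionOfSet P (cover P '' cube P.L a M ρ k 0)).bonds := by
  have hm : P.L ^ 1 * (ρ * gs P.L (k - 1)) + 1 ≤ ρ * gs P.L k := margin_one_add_le hk1 hρ
  rcases hb with h | h
  · obtain ⟨z, hz, hzx⟩ := exists_mem_cube_cover_eq_of_inOm (hk := hk) le_rfl hk1 h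
    refine ⟨⟨z, cube_anti (Nat.zero_le 1) hk1 hz, hzx⟩, ⟨z + Pi.single b.dir 1, ?_, ?_⟩⟩
    · exact mem_cube_zero_of_within hk1 hm hz (by exact_mod_cast within_add_single z b.dir zero_le_one)
    · rw [B15Claim189CubePin.cover_add_single, hzx]; rfl
  · obtain ⟨z, hz, hzx⟩ := exists_mem_cube_cover_eq_of_inOm (hk := hk) le_rfl hk1 h
    refine ⟨⟨z - Pi.single b.dir 1, ?_, ?_⟩, ⟨z, cube_anti (Nat.zero_le 1) hk1 hz, hzx⟩⟩
    · exact mem_cube_zero_of_within hk1 hm hz (by exact_mod_cast within_sub_single z b.dir zero_le_one)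
    · apply eq_of_shift_eq (μ := b.dir)
      rw [← B15Claim189CubePin.cover_add_single, sub_add_cancel, hzx]; rfl

/-- ★★ **CLAUSE (iii)**: every cell of the meet `cubeDomains ⊓ D₂` is fed inside `(regionOfSet (π″□₀)).bonds` or entirely off `R₁` (`1 ≤ k ≤ m + K`, `ρ ≥ 3L`): a level-0 cell is its
own feed; a cell of level `j ≥ 1` has an end block in `Ω_j^{(j)}` of the cube family, so each feeding bond starts within `3Lʲ − 2` (on the cover, after a deck translation) of a point
of `□_j`, and `m_j + 3Lʲ ≤ m₀`. [cite: Balaban1988Convergent, (2.11) p.256; Balaban1985RegularSpaces, p.98, (1.131) p.99; Balaban1984PropagatorsII, (2.3) p.224] -/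
theorem feeds_clause_tower (hk1 : 1 ≤ k) (hρ : 3 * P.L ≤ ρ) {j : ℕ} (c : PBond P j) (hc : (domainsMeet (cubeDomains P a M ρ k hk) D₂).LamBond j c) :
    feeds j c ⊆ (Sect2.regionOfSet P (cover P '' cube P.L a M ρ k 0)).bonds ∨
      Disjoint (feeds j c) {b : PBond P 0 | (cubeDomains P a M ρ k hk).InOm 1 b.src ∨ (cubeDomains P a M ρ k hk).InOm 1 b.tgt} := by
  have hρ1 : 1 ≤ ρ := le_trans (by have := P.L_pos; omega) hρ
  rcases Nat.eq_zero_or_pos j with rfl | hj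
  · -- a level-0 cell is its own feed
    by_cases h0 : c ∈ (Sect2.regionOfSet P (cover P '' cube P.L a M ρ k 0)).bonds
    · exact Or.inl (by rw [feeds_zero]; exact Set.singleton_subset_iff.2 h0)
    · refine Or.inr ?_
      rw [feeds_zero, Set.disjoint_singleton_left]
      exact fun h => h0 (mem_bonds_of_inOm_one hk1 hρ1 h)
  · -- a cell of level `j ≥ 1`: one end block in `Ω_j^{(j)}` of the cube family
    refine Or.inl fun b₀ hb₀ => ?_
    have hjK : j ≤ (domainsMeet (cubeDomains P a M ρ k hk) D₂).k := Domains.le_of_lamBond _ hc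
    have hjk : j ≤ k := hjK.trans (by rw [domainsMeet_k]; exact min_le_left _ _)
    have hjm : j ≤ P.m + P.K := hjk.trans hk
    have hend : c.src ∈ (cubeDomains P a M ρ k hk).Om j ∨ c.tgt ∈ (cubeDomains P a M ρ k hk).Om j := by
      rcases hc.1 with h | h
      · exact Or.inl (domainsMeet_le_left _ _ j h)
      · exact Or.inr (domainsMeet_le_left _ _ j h)
    obtain ⟨x, x₀, hx, hx₀, hw⟩ := feeds_witness hjm c b₀ hb₀
    -- a cover point `x′` within `Lʲ` of `x` whose block label is the end of `c` lying in `Ω_j^{(j)}`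
    obtain ⟨x', y, hy, hx', hxx'⟩ : ∃ (x' : Pt P.d) (y : Site P j), y ∈ (cubeDomains P a M ρ k hk).Om j ∧
        coverAt P j (blockMap (P.L ^ j) x') = y ∧ Within ((P.L ^ j : ℕ) : ℤ) x x' := by
      have hq0 : (0 : ℤ) ≤ ((P.L ^ j : ℕ) : ℤ) := by exact_mod_cast Nat.zero_le _
      rcases hend with h | h
      · have e1 : coverAt P j (blockMap (P.L ^ j) x) = c.src := by
          have h1 := blockIter_cover hjm x
          rw [hx] at h1
          exact h1.symm
        have e2 : Within ((P.L ^ j : ℕ) : ℤ) x x := Within.refl hq0 x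
        exact ⟨x, c.src, h, e1, e2⟩
      · have h2 : B14.Eq22Determines.blockIter j (cover P (x + Pi.single c.dir ((P.L ^ j : ℕ) : ℤ))) = c.tgt := by
          rw [blockIter_cover_add_single hjm, hx]; rfl
        have e1 : coverAt P j (blockMap (P.L ^ j) (x + Pi.single c.dir ((P.L ^ j : ℕ) : ℤ))) = c.tgt := by
          have h1 := blockIter_cover hjm (x + Pi.single c.dir ((P.L ^ j : ℕ) : ℤ))
          rw [h2] at h1
          exact h1.symm
        have e2 : Within ((P.L ^ j : ℕ) : ℤ) x (x + Pi.single c.dir ((P.L ^ j : ℕ) : ℤ)) := within_add_single x c.dir hq0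
        exact ⟨_, c.tgt, h, e1, e2⟩
    obtain ⟨v, hv⟩ := exists_translate_mem_cube_of_coverAt_eq (hk := hk) hj hjk hy hx'
    set w : Pt P.d := fun μ => ((P.sitesPerDir 0 : ℕ) : ℤ) * v μ with hwdef
    -- the translated witness: `x′ + w ∈ □_j`, `x₀ + w` within `3Lʲ − 2` of it, covering `b₀₋`
    have hw1 : Within (3 * ((P.L ^ j : ℕ) : ℤ) - 2) (x' + w) (x₀ + w) := by
      rw [within_add_right_iff]
      have h := (hxx'.symm).triangle hw
      exact Within.mono (by omega) h
    have hcov : cover P (x₀ + w) = b₀.src := by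
      rw [← hx₀, hwdef, ← coverAt_zero, coverAt_add_period 0 x₀ v]
    have hq : 1 ≤ P.L ^ j := Nat.one_le_pow _ _ P.L_pos
    have hm1 : P.L ^ j * (ρ * gs P.L (k - j)) + (3 * P.L ^ j - 2) ≤ ρ * gs P.L k := margin_add_three_pow_le hj hjk hρ (by omega)
    have hm2 : P.L ^ j * (ρ * gs P.L (k - j)) + (3 * P.L ^ j - 1) ≤ ρ * gs P.L k := margin_add_three_pow_le hj hjk hρ (by omega)
    have hc1 : ((3 * P.L ^ j - 2 : ℕ) : ℤ) = 3 * ((P.L ^ j : ℕ) : ℤ) - 2 := by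
      rw [Nat.cast_sub (by omega), Nat.cast_mul]; push_cast; ring
    have hc2 : ((3 * P.L ^ j - 1 : ℕ) : ℤ) = 3 * ((P.L ^ j : ℕ) : ℤ) - 2 + 1 := by
      rw [Nat.cast_sub (by omega), Nat.cast_mul]; push_cast; ring
    have hw2 : Within (3 * ((P.L ^ j : ℕ) : ℤ) - 2 + 1) (x' + w) (x₀ + w + Pi.single b₀.dir 1) :=
      hw1.triangle (within_add_single (x₀ + w) b₀.dir zero_le_one)
    refine ⟨⟨x₀ + w, mem_cube_zero_of_within hjk hm1 hv (by rw [hc1]; exact hw1), hcov⟩,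
      ⟨x₀ + w + Pi.single b₀.dir 1, mem_cube_zero_of_within hjk hm2 hv (by rw [hc2]; exact hw2), ?_⟩⟩
    rw [B15Claim189CubePin.cover_add_single, hcov]; rfl

end Feeds

/-! ## §4  MODULE 103 with the clauses discharged -/

section Compose

open T4Continuum (T4Family)

variable {F : T4Family} {N : ℕ} [NeZero N] {K : ℕ}

/-- ★★★ **PRINT'S CRITICALITY OF THE MINIMISER, TRANSPORTED TO THE GLOBALLY READ CHART CONFIGURATION ON THE PER-CUBE MEET FIBRE** — MODULE 103
`critLam_meet_of_critLam_seq_of_eqOn` with its three clauses supplied by §2–§3 at the (144) tower (`1 ≤ k′ ≤ k`, `k′ ≤ m + K`, `3L ≤ ρ`): from print's criticality of `U` on the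
(2.3) fibre of `W` for the whole sequence family `domainsOfSeq Ω k`, `U` on that fibre, and `Ũ = u • U` on `(regionOfSet (π″□₀)).bonds`, the configuration `Ũ` is critical along
every bondwise-differentiable curve through it lying, near `t = 0`, in the fibre of `cubeDomains ⊓ domainsOfSeq Ω k′` through `Ū(Ũ)`.  The cell-form in-edge of the (d′) supplier.
[cite: Balaban1985Variational, (5)–(6) p.278, (144) p.300, (147)–(153) p.301, Prop. 8 p.304; Balaban1984PropagatorsII, (2.3) p.224; Balaban1988Convergent, (2.10)–(2.12) p.256; Balaban1985RegularSpaces, (1.131) p.99] -/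
theorem critLam_meet_tower_of_critLam_seq_of_eqOn (Ω : ℕ → Set (Site (F.P K) 0)) {k' k : ℕ} (hk'1 : 1 ≤ k') (hk'k : k' ≤ k)
    (hk' : k' ≤ (F.P K).m + (F.P K).K) (hk : k ≤ (F.P K).m + (F.P K).K) (a : Pt (F.P K).d) (M ρ : ℕ) (hρ : 3 * (F.P K).L ≤ ρ)
    {W : MSField (F.P K) (SU N)} {U Ut : GaugeField (F.P K) 0 (SU N)} (u : GaugeTransf (F.P K) 0 (SU N))
    (hagree : ∀ b ∈ (Sect2.regionOfSet (F.P K) (cover (F.P K) '' cube (F.P K).L a M ρ k' 0)).bonds, Ut b = GaugeField.gaugeAct u U b)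
    (hUW : ∀ (j : ℕ) (c : PBond (F.P K) j), (domainsOfSeq Ω k hk).LamBond j c → avgFamily (avOfRecord F N K) U j c = W j c)
    (hcrit : ∀ γ : ℝ → GaugeField (F.P K) 0 (SU N), γ 0 = U →
      DifferentiableAt ℝ (fun (t : ℝ) (b : PBond (F.P K) 0) => ((γ t b : SU N) : Matrix (Fin N) (Fin N) ℂ)) 0 →
        (∀ᶠ t in 𝓝 (0 : ℝ), ∀ (j : ℕ) (c : PBond (F.P K) j), (domainsOfSeq Ω k hk).LamBond j c → avgFamily (avOfRecord F N K) (γ t) j c = W j c) →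
          ∀ a' : ℝ, HasDerivAt (fun t => wilsonAction4 (γ t)) a' 0 → a' = 0) :
    ∀ γ : ℝ → GaugeField (F.P K) 0 (SU N), γ 0 = Ut →
      DifferentiableAt ℝ (fun (t : ℝ) (b : PBond (F.P K) 0) => ((γ t b : SU N) : Matrix (Fin N) (Fin N) ℂ)) 0 →
        (∀ᶠ t in 𝓝 (0 : ℝ), ∀ (j : ℕ) (c : PBond (F.P K) j), (domainsMeet (cubeDomains (F.P K) a M ρ k' hk') (domainsOfSeq Ω k' hk')).LamBond j c →
          avgFamily (avOfRecord F N K) (γ t) j c = avgFamily (avOfRecord F N K) Ut j c) →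
          ∀ a' : ℝ, HasDerivAt (fun t => wilsonAction4 (γ t)) a' 0 → a' = 0 :=
  have hρ1 : 1 ≤ ρ := le_trans (by have := (F.P K).L_pos; omega) hρ
  critLam_meet_of_critLam_seq_of_eqOn Ω hk'k hk' hk (cubeDomains (F.P K) a M ρ k' hk')
    (R₁ := {b : PBond (F.P K) 0 | (cubeDomains (F.P K) a M ρ k' hk').InOm 1 b.src ∨ (cubeDomains (F.P K) a M ρ k' hk').InOm 1 b.tgt})
    (fun b hb => pin_clause_tower a M ρ k' hk' _ b hb) (fun p hp => collar_clause_tower hk'1 hρ1 p hp)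
    (fun j c hc => feeds_clause_tower _ hk'1 hρ c hc) u hagree hUW hcrit

end Compose

end Summit.QuantumFields.YangMills.BalabanUVNodes.N07CritLamTowerClauses

end
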